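import Mathlib
import Literature.Computability.QuantumComplexity.SinkOfVerifiableLine
import Literature.Computability.QuantumComplexity.QueryHybridBound
import Summits.QuantumAdvantage.QuantumAdvantage.Theses.WhiteBoxWalk

/-!
Sketch for crux-ideate stmt-QuantumAdvantage-2239 (WbwVerifiableLineNoSpeedup), ideator 2.
First lemmas of the three idea cards; nothing here is proved (sorry allowed in a sketch),
everything must ELABORATE over existing declarations.
-/

open Literature.Computability.QuantumComplexity Literature.Computability.Cryptography

namespace Summit.QuantumAdvantage.QuantumAdvantage.Cruxes.WbwVerifiableLineNoSpeedup.Sketch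

/-! ### Card `transposition-coupling-reduction`: relabelling invariance of the promise and the
merge-free model J'. -/

section Coupling

variable {m T : ℕ}

/-- Relabel a pair of tables `(S, V)` by a permutation `τ` of the names: `S ↦ τ ∘ S ∘ τ⁻¹`,
`V(x, i) ↦ V(τ⁻¹ x, i)`. -/
def relabel (τ : Equiv.Perm (Fin (2 ^ m))) (S : Fin (2 ^ m) → Fin (2 ^ m))
    (V : Fin (2 ^ m) → Fin (T + 1) → Bool) :
    (Fin (2 ^ m) → Fin (2 ^ m)) × (Fin (2 ^ m) → Fin (T + 1) → Bool) :=
  (fun x => τ (S (τ.symm x)), fun x i => V (τ.symm x) i)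

/-- First lemma (B1): a relabelling fixing the source `0ᵐ` maps SVL instances to SVL instances,
carrying the line `xs` to `τ ∘ xs` (so the coupling `I ↦ τ·I` is a bijection of the promise set;
with `τ = (x_T, x_T ⊕ 1)` it flips the sink bit). -/
theorem relabel_mem_svlPromise (τ : Equiv.Perm (Fin (2 ^ m)))
    (hτ : τ ⟨0, Nat.two_pow_pos m⟩ = ⟨0, Nat.two_pow_pos m⟩)
    {S : Fin (2 ^ m) → Fin (2 ^ m)} {V : Fin (2 ^ m) → Fin (T + 1) → Bool}
    (h : svlInput m T S V ∈ svlPromise m T) :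
    svlInput m T (relabel τ S V).1 (relabel τ S V).2 ∈ svlPromise m T := by
  sorry

/-- The sink-flip transposition: swapping the names `x` and `x xor 1` (low-order bit). -/
def lowBitFlip (m : ℕ) (x : Fin (2 ^ m)) : Fin (2 ^ m) :=
  ⟨(x.val ^^^ 1) % 2 ^ m, Nat.mod_lt _ (Nat.two_pow_pos m)⟩

/-- First lemma (B2, the decision step): if two promise inputs have opposite sink bits, a
bounded-error algorithm separates their final states by `1/6` in `ℓ²` (tree:
`abs_acceptProb_sub_le`). -/
theorem sixth_le_l2Norm'_of_sinkBit_ne {N : ℕ} (A : QQueryAlg N) {D : Set (Fin N → Bool)}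
    {f : (Fin N → Bool) → Bool} (hA : A.ComputesWithError (1 / 3) D f) {t t' : Fin N → Bool}
    (ht : t ∈ D) (ht' : t' ∈ D) (hne : f t ≠ f t') :
    (1 : ℝ) / 6 ≤ l2Norm' (A.finalState t - A.finalState t') := by
  sorry

/-- The merge-free model J': an injective line through `0ᵐ` together with junk values that avoid
the line (off-line successors, and the successor of the sink, are off-line names). -/
structure MergeFreeInstance (m T : ℕ) where
  line : Fin (T + 1) ↪ Fin (2 ^ m)
  source : (line 0).val = 0
  junk : Fin (2 ^ m) → Fin (2 ^ m)
  junk_offline : ∀ y, (∀ i : Fin T, y ≠ line i.castSucc) → ∀ i, junk y ≠ line i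

/-- The successor table of a merge-free instance. -/
noncomputable def MergeFreeInstance.succ (I : MergeFreeInstance m T) (y : Fin (2 ^ m)) :
    Fin (2 ^ m) := by
  classical
  exact if h : ∃ i : Fin T, y = I.line i.castSucc then I.line (Classical.choose h).succ else I.junk y

/-- The verifier table of a merge-free instance. -/
def MergeFreeInstance.verify (I : MergeFreeInstance m T) (y : Fin (2 ^ m)) (i : Fin (T + 1)) :
    Bool := decide (y = I.line i)

/-- Model J' is supported on the promise set. -/
theorem MergeFreeInstance.mem_svlPromise (I : MergeFreeInstance m T) :
    svlInput m T I.succ I.verify ∈ svlPromise m T := by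
  sorry

/-- The `m` input positions holding the S-row of the name `x` (its query mass is the
`queryMagnitude` of this block, `QueryHybridBound.lean`). -/
noncomputable def succRow (m T : ℕ) (x : Fin (2 ^ m)) : Finset (Fin (2 ^ m * m + 2 ^ m * (T + 1))) :=
  Finset.univ.image (svlSuccIndex m T x)

/-- THE NON-ELEMENTARY STUB of card B (= the output of card A): the sharp deep-vertex guessing
lemma, S-only form. Uniformly over the merge-free model (finite average over all instances with
the V-table blanked), a `q`-query algorithm whose measured output register is read as a name by
`out` guesses the level-`j` vertex, `j ≥ q + 3`, with probability at most `K / 2ᵐ`, as long as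
`q ≤ c₀ √(2ᵐ)` and the line occupies at most half of the names. -/
def DeepGuessingLemma : Prop :=
  ∃ K c₀ : ℝ, 0 < K ∧ 0 < c₀ ∧ ∀ (m T q j : ℕ) [Fintype (MergeFreeInstance m T)]
    [Nonempty (MergeFreeInstance m T)]
    (A : QQueryAlg (2 ^ m * m + 2 ^ m * (T + 1)))
    (out : (Fin (2 ^ m * m + 2 ^ m * (T + 1)) × Bool × A.W) → Fin (2 ^ m)),
    A.queries = q → q + 3 ≤ j → (hj : j ≤ T) → 2 * (T + 1) ≤ 2 ^ m →
    (q : ℝ) ≤ c₀ * Real.sqrt (2 ^ m) →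
    (∑ I : MergeFreeInstance m T,
        ∑ s : Fin (2 ^ m * m + 2 ^ m * (T + 1)) × Bool × A.W,
          if out s = I.line ⟨j, Nat.lt_succ_of_le hj⟩
          then ‖A.finalState (svlInput m T I.succ fun _ _ => false) s‖ ^ 2 else 0) /
      (Fintype.card (MergeFreeInstance m T) : ℝ) ≤ K / 2 ^ m

end Coupling

/-! ### Card `mergefree-line-recording`: the combinatorial core of the recording argument —
a recorded partial injection with `q` entries pins at most the first `q` levels. -/

section Recording

variable {N : ℕ}

/-- Follow a partial (recorded) successor table from `x₀` for `k` steps. -/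
def dbChain (D : Fin N → Option (Fin N)) (x₀ : Fin N) : ℕ → Option (Fin N)
  | 0 => some x₀
  | k + 1 => (dbChain D x₀ k).bind D

/-- First lemma (A1): if the database records at most `q` entries, is injective on its recorded
values and never points back to the source, then the chain from the source is undefined after
`q + 1` steps — "q recorded links cannot pin level `q + 1`", the structural (loss-free)
sequentiality fact that replaces Ozhigov/CFHL-type probability bounds inside a recording proof. -/
theorem dbChain_eq_none (D : Fin N → Option (Fin N)) (x₀ : Fin N) (q : ℕ)
    (hcard : (Finset.univ.filter fun x => (D x).isSome).card ≤ q)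
    (hinj : ∀ x y v, D x = some v → D y = some v → x = y)
    (hsrc : ∀ x, D x ≠ some x₀) :
    dbChain D x₀ (q + 1) = none := by
  sorry

end Recording

/-! ### Card `prefix-depth-adversary`: the general (negative-weight) adversary bound in the tree's
model, the theorem the explicit dual matrix is fed into. -/

section Adversary

variable {N : ℕ}

/-- The `i`-th difference filter `Γ ∘ Δᵢ`: keep the entries at pairs of inputs differing in bit `i`. -/
def hadamardDiff (Γ : Matrix (Fin N → Bool) (Fin N → Bool) ℝ) (i : Fin N) :
    Matrix (Fin N → Bool) (Fin N → Bool) ℝ :=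
  fun x y => if x i ≠ y i then Γ x y else 0

/-- First lemma (C1, to be vendored/proved: Høyer–Lee–Špalek 2007 Thm 2 / Lee–Mittal–Reichardt–
Špalek–Szegedy 2011): the negative-weight adversary lower bound in the `QQueryAlg` model, for
PARTIAL functions: for every real symmetric `Γ` supported on pairs of promise inputs with different
`f`-values, every `1/3`-error algorithm makes at least `c · ‖Γ‖ / maxᵢ ‖Γ ∘ Δᵢ‖` queries (spectral
norms, via `Matrix.toEuclideanCLM`). -/
def NegativeAdversaryBound : Prop :=
  ∃ c : ℝ, 0 < c ∧ ∀ (N : ℕ) (D : Set (Fin N → Bool)) (f : (Fin N → Bool) → Bool)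
    (Γ : Matrix (Fin N → Bool) (Fin N → Bool) ℝ), Γ.IsSymm →
    (∀ x y, Γ x y ≠ 0 → x ∈ D ∧ y ∈ D ∧ f x ≠ f y) →
    ∀ (A : QQueryAlg N), A.ComputesWithError (1 / 3) D f →
    ∀ (L : ℝ), (∀ i, ‖Matrix.toEuclideanCLM (𝕜 := ℝ) (hadamardDiff Γ i)‖ ≤ L) → 0 < L →
      c * ‖Matrix.toEuclideanCLM (𝕜 := ℝ) Γ‖ / L ≤ A.queries

/-- Consequence used by the card: an adversary matrix for SVL with ratio `≥ min (T+1) √(2ᵐ) / m`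
closes the crux (given `NegativeAdversaryBound` and attainment of the infimum,
`exists_queries_eq_quantumQueryComplexityOn`). -/
theorem crux_of_adversaryMatrix (hADV : NegativeAdversaryBound)
    (hΓ : ∃ c₁ : ℝ, 0 < c₁ ∧ ∀ m T : ℕ, 2 ≤ m → 1 ≤ T → T + 1 ≤ 2 ^ (m - 1) →
      ∃ (Γ : Matrix (SVLInput m T) (SVLInput m T) ℝ) (L : ℝ), Γ.IsSymm ∧ 0 < L ∧
        (∀ x y, Γ x y ≠ 0 → x ∈ svlPromise m T ∧ y ∈ svlPromise m T ∧
          svlSinkBit m T x ≠ svlSinkBit m T y) ∧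
        (∀ i, ‖Matrix.toEuclideanCLM (𝕜 := ℝ) (hadamardDiff Γ i)‖ ≤ L) ∧
        c₁ * min ((T : ℝ) + 1) (Real.sqrt (2 ^ m)) / m * L ≤
          ‖Matrix.toEuclideanCLM (𝕜 := ℝ) Γ‖) :
    Summit.QuantumAdvantage.QuantumAdvantage.Theses.WhiteBoxWalk.WbwVerifiableLineNoSpeedup := by
  sorry

end Adversary

end Summit.QuantumAdvantage.QuantumAdvantage.Cruxes.WbwVerifiableLineNoSpeedup.Sketch
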